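import Literature.Analysis.Complex.PelletTheorem
import HarnessLib

/-!
# The Taylor shift by the complete Horner scheme, and Pellet's test on its output

Topic `Literature/Analysis/Complex` (companion of `PelletTheorem.lean`). Pellet's test at a centre
`c` needs the Taylor coefficients `bₖ = p⁽ᵏ⁾(c)/k! = (taylor c p).coeff k` of a polynomial given
by its coefficient list. The classical way to compute them exactly is the **complete Horner
scheme** [EngelnmullgesUhlig1996, §3.2]: the (first-level) Horner scheme at `x₀` is synthetic
division by `X - x₀` — it returns `P(x₀)` and the coefficients of the quotient `P₁` in
`P(x) = P(x₀) + (x - x₀) P₁(x)` ((3.4)–(3.5)) — and repeating it on the successive quotients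
yields `P(x₀), P₁(x₀) = P'(x₀), P₂(x₀) = P''(x₀)/2!, …`, the Taylor coefficients of `P` at `x₀`
(Computational Scheme 3.1).

Contents (everything PROVED, over any commutative ring `R`):
* `ofList l` — the polynomial with little-endian coefficient list `l` ((3.1)), `coeff_ofList`,
  `natDegree_ofList_lt`;
* `synthDiv x₀ l` — the Horner scheme (3.4); `ofList_eq_synthDiv` — it is division by `X - x₀`
  with remainder `P(x₀)` (3.5); `eval_ofList_eq_headD_synthDiv` — Horner's rule;
* `taylorShift x₀ l` — the complete Horner scheme; `ofList_taylorShift` —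
  `ofList (taylorShift x₀ l) = taylor x₀ (ofList l)`; `getD_taylorShift` — entrywise, the `k`-th
  output is `(taylor x₀ P).coeff k = (hasseDeriv k P)(x₀)`;
* `pellet_taylorShift` — Pellet's theorem (`Pellet.pellet`) with its hypothesis read off the
  output of `taylorShift` over `ℂ`.

Dictionary with `cap.roots.pellet` (engines `cap` 0.2.24): `_shift_coeffs(p, c)` is
`taylorShift c p` — the same double loop, pass `i` running `q[j] += c·q[j+1]` for
`j = n-2, …, i` and freezing entry `i` (the top entry is never touched; here it is computed as
`a_d + x₀·0`) — so `_shift_coeffs(p, c)[k] = (taylor c (ofList p)).coeff k` (`getD_taylorShift`),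
which is the quantity `b[k]` entering `pellet_exact` / `pellet_iv` (`pellet_taylorShift`,
`Pellet.pellet_of_bounds`).

References:
* [EngelnmullgesUhlig1996] G. Engeln-Müllges, F. Uhlig, *Numerical Algorithms with Fortran*,
  Springer (1996), §3.1 (3.1), §3.2.1 (Horner scheme, (3.4)–(3.5)), §3.2.3 (complete Horner
  scheme, Computational Scheme 3.1).
* [BeckerEtAl2018] R. Becker, M. Sagraloff, V. Sharma, C. Yap, J. Symbolic Comput. 86 (2018),
  §3.1 Thm. 1 (Pellet's theorem in the `T_k`-test form).
-/

open _root_.Polynomial Finset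

noncomputable section

namespace Literature.Analysis.Complex.Pellet

section TaylorShift

variable {R : Type*} [CommRing R]

/-- The polynomial with little-endian coefficient list `l`: `ofList [a₀, a₁, …, a_d] = ∑ aₖ Xᵏ`,
i.e. `ofList (a :: l) = C a + X · ofList l`. (Coefficients in any commutative ring — for the root
isolator, Gaussian rationals inside `ℂ`; the tree's `ℤ`-valued list models in
`Literature.Algebra.Polynomial.CoeffList` do not apply.)
[cite: EngelnmullgesUhlig1996, §3.1 (3.1)] -/
def ofList : List R → R[X]
  | [] => 0
  | a :: l => C a + X * ofList l

/-- `ofList [] = 0` (the empty coefficient list). [cite: EngelnmullgesUhlig1996, §3.1 (3.1)] -/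
@[simp] theorem ofList_nil : ofList ([] : List R) = 0 := rfl

/-- `ofList (a :: l) = C a + X · ofList l`. [cite: EngelnmullgesUhlig1996, §3.1 (3.1)] -/
@[simp] theorem ofList_cons (a : R) (l : List R) : ofList (a :: l) = C a + X * ofList l := rfl

/-- `ofList [a₀, …, a_d] = ∑ⱼ aⱼ Xʲ`: the coefficients of `ofList l` are the entries of `l` (and `0`
beyond its length). [cite: EngelnmullgesUhlig1996, §3.1 (3.1)] -/
theorem coeff_ofList : ∀ (l : List R) (k : ℕ), (ofList l).coeff k = l.getD k 0
  | [], k => by simp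
  | a :: l, 0 => by simp
  | a :: l, k + 1 => by simp [coeff_ofList l k]

/-- `deg (ofList [a₀, …, a_d]) ≤ d`: a nonempty coefficient list of length `n` gives a polynomial of
degree `< n`. [cite: EngelnmullgesUhlig1996, §3.1 (3.1)] -/
theorem natDegree_ofList_lt {l : List R} (hl : l ≠ []) : (ofList l).natDegree < l.length := by
  have hlen : 0 < l.length := List.length_pos_iff.2 hl
  have : (ofList l).natDegree ≤ l.length - 1 :=
    (natDegree_le_iff_coeff_eq_zero).2 fun N hN => by
      rw [coeff_ofList, List.getD_eq_default _ _ (by omega)]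
  omega

/-- **The (first-level) Horner scheme = synthetic division by `X - x₀`.** From the little-endian
coefficients `[a₀, …, a_d]` of `P` and a point `x₀` it returns `[a₀⁽¹⁾, …, a_d⁽¹⁾]` with
`a_d⁽¹⁾ = a_d` and `aⱼ⁽¹⁾ = aⱼ + x₀ · aⱼ₊₁⁽¹⁾` for `j = d - 1, …, 0` (here the top entry is computed
as `a_d + x₀ · 0`). Then `a₀⁽¹⁾ = P(x₀)` and `[a₁⁽¹⁾, …, a_d⁽¹⁾]` are the coefficients of the
quotient `P₁` in `P(x) = (x - x₀) P₁(x) + P(x₀)` (`ofList_eq_synthDiv`). This is the inner loop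
`q[j] += c * q[j+1] (j = n-2, …, i)` of a Taylor shift by repeated synthetic division.
[cite: EngelnmullgesUhlig1996, §3.2.1 (3.4)] -/
def synthDiv (x₀ : R) : List R → List R
  | [] => []
  | a :: l => (a + x₀ * (synthDiv x₀ l).headD 0) :: synthDiv x₀ l

/-- `synthDiv x₀ [] = []`. [cite: EngelnmullgesUhlig1996, §3.2.1 (3.4)] -/
@[simp] theorem synthDiv_nil (x₀ : R) : synthDiv x₀ ([] : List R) = [] := rfl

/-- The Horner recursion `aⱼ⁽¹⁾ = aⱼ + x₀ · aⱼ₊₁⁽¹⁾`.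
[cite: EngelnmullgesUhlig1996, §3.2.1 (3.4)] -/
@[simp] theorem synthDiv_cons (x₀ a : R) (l : List R) :
    synthDiv x₀ (a :: l) = (a + x₀ * (synthDiv x₀ l).headD 0) :: synthDiv x₀ l := rfl

/-- The Horner scheme has as many entries as the input.
[cite: EngelnmullgesUhlig1996, §3.2.1 (3.4)] -/
@[simp] theorem length_synthDiv (x₀ : R) : ∀ l : List R, (synthDiv x₀ l).length = l.length
  | [] => rfl
  | a :: l => by rw [synthDiv_cons, List.length_cons, List.length_cons, length_synthDiv x₀ l]

/-- `ofList s = C (head s) + X · ofList (tail s)` (with head `0` for the empty list). [folklore] -/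
private theorem ofList_eq_headD (s : List R) : ofList s = C (s.headD 0) + X * ofList s.tail := by
  cases s <;> simp

/-- **Synthetic division is division by `X - x₀` with remainder `P(x₀)`**:
`P(x) = P(x₀) + (x - x₀) · P₁(x)` where `P(x₀) = a₀⁽¹⁾` is the head of the Horner scheme and `P₁`
has the remaining entries `a₁⁽¹⁾, …, a_d⁽¹⁾` as coefficients.
[cite: EngelnmullgesUhlig1996, §3.2.1 (3.5)] -/
theorem ofList_eq_synthDiv (x₀ : R) : ∀ l : List R,
    ofList l = C ((synthDiv x₀ l).headD 0) + (X - C x₀) * ofList (synthDiv x₀ l).tail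
  | [] => by simp
  | a :: l => by
    rw [synthDiv_cons, List.headD_cons, List.tail_cons, ofList_cons, ofList_eq_synthDiv x₀ l,
      ofList_eq_headD (synthDiv x₀ l)]
    simp only [map_add, map_mul]
    ring

/-- **Horner's rule**: the head `a₀⁽¹⁾` of the Horner scheme at `x₀` is the value `P(x₀)`.
[cite: EngelnmullgesUhlig1996, §3.2.1 (3.4)] -/
theorem eval_ofList_eq_headD_synthDiv (x₀ : R) (l : List R) :
    (ofList l).eval x₀ = (synthDiv x₀ l).headD 0 := by
  conv_lhs => rw [ofList_eq_synthDiv x₀ l]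
  simp

/-- **The complete Horner scheme** (Taylor shift by repeated synthetic division): run the Horner
scheme at `x₀`, keep its head `P(x₀)`, and recurse on the quotient coefficients; the output list
is `[P(x₀), P₁(x₀), P₂(x₀), …] = [P(x₀), P'(x₀), P''(x₀)/2!, …]`, the Taylor coefficients of `P`
at `x₀` (`ofList_taylorShift`). This is `_shift_coeffs` of `cap.roots.pellet`: pass `i` applies
the inner loop to the entries `i, …, d` and freezes entry `i`.
[cite: EngelnmullgesUhlig1996, §3.2.3 Computational Scheme 3.1] -/
def taylorShift (x₀ : R) : List R → List R
  | [] => []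
  | a :: l => (a + x₀ * (synthDiv x₀ l).headD 0) :: taylorShift x₀ (synthDiv x₀ l)
termination_by l => l.length
decreasing_by simp

/-- `taylorShift x₀ [] = []`. [cite: EngelnmullgesUhlig1996, §3.2.3 Computational Scheme 3.1] -/
@[simp] theorem taylorShift_nil (x₀ : R) : taylorShift x₀ ([] : List R) = [] := by
  rw [taylorShift]

/-- One pass of the complete Horner scheme: keep the remainder, continue with the quotient.
[cite: EngelnmullgesUhlig1996, §3.2.3 Computational Scheme 3.1] -/
@[simp] theorem taylorShift_cons (x₀ a : R) (l : List R) :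
    taylorShift x₀ (a :: l) =
      (a + x₀ * (synthDiv x₀ l).headD 0) :: taylorShift x₀ (synthDiv x₀ l) := by
  rw [taylorShift]

/-- The complete Horner scheme has as many entries as the input.
[cite: EngelnmullgesUhlig1996, §3.2.3 Computational Scheme 3.1] -/
@[simp] theorem length_taylorShift (x₀ : R) (l : List R) :
    (taylorShift x₀ l).length = l.length := by
  induction l using taylorShift.induct x₀ with
  | case1 => simp
  | case2 a l ih => rw [taylorShift_cons, List.length_cons, ih, length_synthDiv, List.length_cons]

/-- **The complete Horner scheme computes the Taylor expansion at `x₀`**: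
`ofList (taylorShift x₀ l) = taylor x₀ (ofList l)`, i.e. `P(x) = ∑ₖ tₖ (x - x₀)ᵏ` for the output
`[t₀, t₁, …]`; equivalently `tₖ = P⁽ᵏ⁾(x₀)/k!` (`getD_taylorShift`). Proof: by `ofList_eq_synthDiv`,
`P = P(x₀) + (X - x₀) P₁`, and `taylor x₀` is an algebra map sending `X - C x₀` to `X`.
[cite: EngelnmullgesUhlig1996, §3.2.3 Computational Scheme 3.1] -/
theorem ofList_taylorShift (x₀ : R) (l : List R) :
    ofList (taylorShift x₀ l) = taylor x₀ (ofList l) := by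
  induction l using taylorShift.induct x₀ with
  | case1 => simp
  | case2 a l ih =>
    rw [taylorShift_cons, ofList_cons, ih, ofList_eq_synthDiv x₀ (a :: l), synthDiv_cons,
      List.headD_cons, List.tail_cons]
    simp only [map_add, taylor_mul, map_sub, taylor_C, taylor_X]
    ring

/-- Entrywise: the `k`-th output of the complete Horner scheme is the `k`-th Taylor coefficient
`(taylor x₀ P).coeff k = (hasseDeriv k P)(x₀) = P⁽ᵏ⁾(x₀)/k!` (and `0` beyond the degree).
[cite: EngelnmullgesUhlig1996, §3.2.3 Computational Scheme 3.1] -/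
theorem getD_taylorShift (x₀ : R) (l : List R) (k : ℕ) :
    (taylorShift x₀ l).getD k 0 = (taylor x₀ (ofList l)).coeff k ∧
      (taylorShift x₀ l).getD k 0 = (hasseDeriv k (ofList l)).eval x₀ := by
  rw [← ofList_taylorShift, coeff_ofList, ← taylor_coeff, ← ofList_taylorShift, coeff_ofList]
  exact ⟨rfl, rfl⟩

/-- **Pellet's test on the output of the Taylor shift** (the shape of an exact implementation):
for a coefficient list `l` over `ℂ`, `b = taylorShift c l`, `r > 0` and an index `m`, the
inequality `∑_{k < #l, k ≠ m} ‖b[k]‖ rᵏ < ‖b[m]‖ rᵐ` certifies that `ofList l` has no zero on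
`‖z - c‖ = r` and exactly `m` zeros with multiplicity in `‖z - c‖ < r`.
[cite: BeckerEtAl2018, §3.1 Thm. 1] -/
theorem pellet_taylorShift {l : List ℂ} {c : ℂ} {r : ℝ} (hr : 0 < r) {m : ℕ}
    (hP : ∑ k ∈ (range l.length).erase m, ‖(taylorShift c l).getD k 0‖ * r ^ k <
      ‖(taylorShift c l).getD m 0‖ * r ^ m) :
    (∀ z : ℂ, ‖z - c‖ = r → (ofList l).eval z ≠ 0) ∧
      Multiset.card ((ofList l).roots.filter fun ζ => ‖ζ - c‖ < r) = m := by
  have hl : l ≠ [] := by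
    rintro rfl
    simp at hP
  simp only [(getD_taylorShift c l _).1] at hP
  exact pellet hr (natDegree_ofList_lt hl) hP

end TaylorShift

end Literature.Analysis.Complex.Pellet
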